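import Mathlib.MeasureTheory.Measure.Lebesgue.VolumeOfBalls
import Mathlib.Analysis.SpecialFunctions.Gamma.BohrMollerup
import Mathlib.MeasureTheory.Measure.Haar.InnerProductSpace
import Literature.MathematicalPhysics.StatisticalMechanics.FccSurfaceTension
import HarnessLib

/-!
# The fcc Wulff body has volume (at least) `32`

Topic `Literature/MathematicalPhysics/StatisticalMechanics`; companion of `FccSurfaceTension.lean`
(`phiFcc`, the fcc broken-bond surface tension in deficiency units, `= h_W` for the truncated
octahedron `W = conv{perm(0, ±1, ±2)} = {‖ζ‖_∞ ≤ 2} ∩ {‖ζ‖₁ ≤ 3}` of volume `32`; Cicalese–Kreutz–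
Leonardi 2023, Prop. 2.4 (24) and its proof, Step 3, halved normalisation). This file proves the
two facts about `W` that the Wulff inequality consumes (venture `Summits/Ventures/Crystal3D`, crux
`PolycrystalWulffBound`, single-grain case `3·|W|^{1/3}|G|^{2/3} = 3·∛32·|G|^{2/3}`):

* `inner_le_phiFcc_of_mem_truncOct`: every `x` with `‖x‖_∞ ≤ 2`, `‖x‖₁ ≤ 3` satisfies the support
  inequalities `⟪x, μ⟫ ≤ φ_fcc(μ)` for all `μ` (so the cube–octahedron intersection lies in the
  Wulff body `{x | ∀ μ, ⟪x, μ⟫ ≤ φ_fcc μ}`);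
* `le_volume_truncOct`, `le_volume_fccWulffSet`: `32 ≤ vol({‖x‖_∞ ≤ 2} ∩ {‖x‖₁ ≤ 3}) ≤ vol(W)`,
  computed as the `ℓ¹`-ball of radius `3` (volume `36`, Mathlib's `volume_sum_rpow_le`) minus six
  tips, each congruent to half of the unit `ℓ¹`-ball (volume `≤ 2/3`).

Only the lower bound `32 ≤ vol` is proved (it is what the isoperimetric constant needs); the
equality is not.

## References
* M. Cicalese, L. Kreutz, G. P. Leonardi, *Emergence of Wulff-crystals from atomistic systems on
  the FCC and HCP lattices*, CMP 402 (2023), Prop. 2.4 (24), proof Step 3.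
  [`CicaleseKreutzLeonardi2023`]
-/

noncomputable section

namespace Literature.MathematicalPhysics.StatisticalMechanics

open _root_.MeasureTheory _root_.MeasureTheory.Measure Set WithLp
open scoped RealInnerProductSpace ENNReal

/-! ### The cube–octahedron intersection lies in the Wulff body -/

/-- For `0 ≤ a_i ≤ 2` with `a₀ + a₁ + a₂ ≤ 3` and `m_i ≥ 0`:
`Σ a_i m_i ≤ max(m₀,m₁) + max(m₀,m₂) + max(m₁,m₂)` (`= 2·largest + second` of the `m`'s).
[folklore] -/
private theorem sum_mul_le_sum_max {a₀ a₁ a₂ m₀ m₁ m₂ : ℝ} (h0 : 0 ≤ a₀) (h1 : 0 ≤ a₁)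
    (h2 : 0 ≤ a₂) (h0' : a₀ ≤ 2) (h1' : a₁ ≤ 2) (h2' : a₂ ≤ 2) (hs : a₀ + a₁ + a₂ ≤ 3)
    (hm0 : 0 ≤ m₀) (hm1 : 0 ≤ m₁) (hm2 : 0 ≤ m₂) :
    a₀ * m₀ + a₁ * m₁ + a₂ * m₂ ≤ max m₀ m₁ + max m₀ m₂ + max m₁ m₂ := by
  rcases le_total m₀ m₁ with h01 | h01 <;> rcases le_total m₀ m₂ with h02 | h02 <;>
    rcases le_total m₁ m₂ with h12 | h12 <;>
    simp only [max_eq_right, max_eq_left, h01, h02, h12] <;> nlinarith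

/-- **The truncated octahedron `{‖x‖_∞ ≤ 2} ∩ {‖x‖₁ ≤ 3}` lies in the fcc Wulff body**:
`⟪x, μ⟫ ≤ φ_fcc(μ)` for all `μ` ("`W_{ϕ_FCC}` is the intersection of a cube with an octahedron",
halved normalisation). [cite: CicaleseKreutzLeonardi2023, Proposition 2.4 (24), proof Step 3] -/
theorem inner_le_phiFcc_of_mem_truncOct {x : EuclideanSpace ℝ (Fin 3)} (hx : ∀ i, |x i| ≤ 2)
    (hx' : ∑ i, |x i| ≤ 3) (μ : EuclideanSpace ℝ (Fin 3)) : ⟪x, μ⟫ ≤ phiFcc μ := by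
  rw [phiFcc_eq_sum_max]
  have hinner : ⟪x, μ⟫ = x 0 * μ 0 + x 1 * μ 1 + x 2 * μ 2 := by
    simp [EuclideanSpace.inner_eq_star_dotProduct, dotProduct, Fin.sum_univ_three, mul_comm]
  rw [hinner]
  have hsum : |x 0| + |x 1| + |x 2| ≤ 3 := by simpa [Fin.sum_univ_three] using hx'
  have hb : ∀ i, x i * μ i ≤ |x i| * |μ i| := fun i => by
    rw [← abs_mul]; exact le_abs_self _
  refine ((add_le_add (add_le_add (hb 0) (hb 1)) (hb 2))).trans ?_
  exact sum_mul_le_sum_max (abs_nonneg _) (abs_nonneg _) (abs_nonneg _) (hx 0) (hx 1) (hx 2)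
    hsum (abs_nonneg _) (abs_nonneg _) (abs_nonneg _)

/-! ### Volume of the truncated octahedron: `ℓ¹`-balls in `Fin 3 → ℝ` -/

/-- Volume of the `ℓ¹`-ball of radius `r ≥ 0` in `ℝ³` (as `Fin 3 → ℝ`): `(4/3) r³`. [folklore] -/
private theorem volume_l1Ball (r : ℝ) :
    volume {f : Fin 3 → ℝ | ∑ i, |f i| ≤ r} = ENNReal.ofReal r ^ 3 * ENNReal.ofReal (4 / 3) := by
  have h := MeasureTheory.volume_sum_rpow_le (ι := Fin 3) (p := 1) le_rfl r
  simp only [Real.rpow_one, div_one, Fintype.card_fin] at h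
  rw [show (1 : ℝ) + 1 = 2 by norm_num, Real.Gamma_two, Real.Gamma_nat_eq_factorial 3] at h
  rw [h]
  norm_num [Nat.factorial]

/-- The half `ℓ¹`-ball `{Σ|w_j| ≤ 1, 0 < s·w_i}` (`s = ±1`) has volume `≤ 2/3`: it and its mirror
image are disjoint in the unit `ℓ¹`-ball of volume `4/3`. [folklore] -/
private theorem volume_halfBall_le (i : Fin 3) (s : ℝ) :
    volume {w : Fin 3 → ℝ | 0 < s * w i ∧ ∑ j, |w j| ≤ 1} ≤ ENNReal.ofReal (2 / 3) := by
  set H : ℝ → Set (Fin 3 → ℝ) := fun s => {w | 0 < s * w i ∧ ∑ j, |w j| ≤ 1} with hH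
  -- the mirror image under `w ↦ -w`
  have hneg : ∀ s : ℝ, H (-s) = Neg.neg ⁻¹' H s := by
    intro s; ext w; simp [hH, Pi.neg_apply, abs_neg]
  have hvol : ∀ s : ℝ, volume (H (-s)) = volume (H s) := by
    intro s; rw [hneg, measure_preimage_neg]
  have hmeas : ∀ s : ℝ, MeasurableSet (H s) := by
    intro s
    have hci : Measurable fun w : Fin 3 → ℝ => w i := measurable_pi_apply i
    have hsum : Measurable fun w : Fin 3 → ℝ => ∑ j, |w j| :=
      Finset.measurable_sum _ fun j _ => (continuous_apply j).abs.measurable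
    show MeasurableSet {w : Fin 3 → ℝ | 0 < s * w i ∧ ∑ j, |w j| ≤ 1}
    rw [Set.setOf_and]
    exact (measurableSet_lt measurable_const (hci.const_mul s)).inter
      (measurableSet_le hsum measurable_const)
  have hdisj : Disjoint (H s) (H (-s)) := by
    rw [Set.disjoint_left]
    rintro w ⟨h1, -⟩ ⟨h2, -⟩
    have : s * w i < 0 := by linarith
    exact absurd h1 (not_lt.2 this.le)
  have hsub : H s ∪ H (-s) ⊆ {f : Fin 3 → ℝ | ∑ i, |f i| ≤ 1} := by
    rintro w (⟨-, hw⟩ | ⟨-, hw⟩) <;> exact hw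
  have key : volume (H s) + volume (H s) ≤ ENNReal.ofReal 1 ^ 3 * ENNReal.ofReal (4 / 3) := by
    calc volume (H s) + volume (H s) = volume (H s) + volume (H (-s)) := by rw [hvol]
      _ = volume (H s ∪ H (-s)) := (measure_union hdisj (hmeas _)).symm
      _ ≤ _ := by rw [← volume_l1Ball 1]; exact measure_mono hsub
  rw [ENNReal.ofReal_one, one_pow, one_mul, show (4 : ℝ) / 3 = 2 / 3 + 2 / 3 by norm_num,
    ENNReal.ofReal_add (by norm_num) (by norm_num)] at key
  by_contra h
  push Not at h
  exact absurd key (not_le.2 (ENNReal.add_lt_add h h))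

/-- A tip `{2 < s·f_i, Σ|f_j| ≤ 3}` of the radius-`3` `ℓ¹`-ball translates into the half unit
ball, hence has volume `≤ 2/3`. [folklore] -/
private theorem volume_tip_le (i : Fin 3) {s : ℝ} (hs : s = 1 ∨ s = -1) :
    volume {f : Fin 3 → ℝ | 2 < s * f i ∧ ∑ j, |f j| ≤ 3} ≤ ENNReal.ofReal (2 / 3) := by
  have hs2 : s * s = 1 := by rcases hs with rfl | rfl <;> norm_num
  set c : Fin 3 → ℝ := Function.update 0 i (2 * s) with hc
  have hci : c i = 2 * s := by simp [hc]
  have hcj : ∀ j, j ≠ i → c j = 0 := fun j hj => by simp [hc, hj]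
  -- translate by `-c`
  have htrans : {f : Fin 3 → ℝ | 2 < s * f i ∧ ∑ j, |f j| ≤ 3} =
      (fun w => w + c) '' ((fun w => w + c) ⁻¹' {f : Fin 3 → ℝ | 2 < s * f i ∧ ∑ j, |f j| ≤ 3}) :=
    (Set.image_preimage_eq _ (fun f => ⟨f - c, by simp⟩)).symm
  have hsub : (fun w => w + c) ⁻¹' {f : Fin 3 → ℝ | 2 < s * f i ∧ ∑ j, |f j| ≤ 3} ⊆
      {w : Fin 3 → ℝ | 0 < s * w i ∧ ∑ j, |w j| ≤ 1} := by
    intro w hw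
    simp only [Set.mem_preimage, Set.mem_setOf_eq, Pi.add_apply, hci] at hw
    obtain ⟨hw1, hw2⟩ := hw
    have hwi : 0 < s * w i := by nlinarith
    refine ⟨hwi, ?_⟩
    -- the `i`-th term carries the extra `2`
    have hterm : |w i + 2 * s| = |w i| + 2 := by
      rcases hs with rfl | rfl
      · rw [abs_of_pos (by linarith), abs_of_pos (by linarith)]; ring
      · rw [abs_of_neg (by linarith), abs_of_neg (by linarith)]; ring
    have hsplit : ∑ j, |w j + c j| = (∑ j, |w j|) + 2 := by
      rw [← Finset.sum_erase_add _ _ (Finset.mem_univ i),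
        ← Finset.sum_erase_add (Finset.univ) (fun j => |w j|) (Finset.mem_univ i), hci, hterm]
      have : ∑ j ∈ Finset.univ.erase i, |w j + c j| = ∑ j ∈ Finset.univ.erase i, |w j| :=
        Finset.sum_congr rfl fun j hj => by rw [hcj j (Finset.ne_of_mem_erase hj), add_zero]
      rw [this]; ring
    linarith
  calc volume {f : Fin 3 → ℝ | 2 < s * f i ∧ ∑ j, |f j| ≤ 3}
      = volume ((fun w => w + c) ⁻¹' {f : Fin 3 → ℝ | 2 < s * f i ∧ ∑ j, |f j| ≤ 3}) :=
        (measure_preimage_add_right _ _ _).symm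
    _ ≤ volume {w : Fin 3 → ℝ | 0 < s * w i ∧ ∑ j, |w j| ≤ 1} := measure_mono hsub
    _ ≤ ENNReal.ofReal (2 / 3) := volume_halfBall_le i s

/-- Volume of the truncated octahedron in coordinates `Fin 3 → ℝ`:
`32 ≤ vol {Σ|f_i| ≤ 3, |f_i| ≤ 2}` (`ℓ¹`-ball `36` minus six tips `≤ 2/3` each). [folklore] -/
private theorem le_volume_truncOct_pi :
    ENNReal.ofReal 32 ≤ volume {f : Fin 3 → ℝ | (∀ i, |f i| ≤ 2) ∧ ∑ i, |f i| ≤ 3} := by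
  set O : Set (Fin 3 → ℝ) := {f | ∑ i, |f i| ≤ 3} with hO
  set T : Set (Fin 3 → ℝ) := {f | (∀ i, |f i| ≤ 2) ∧ ∑ i, |f i| ≤ 3} with hT
  set tip : Fin 3 → ℝ → Set (Fin 3 → ℝ) := fun i s => {f | 2 < s * f i ∧ ∑ j, |f j| ≤ 3}
    with htip
  have hcover : O ⊆ T ∪ ⋃ i, (tip i 1 ∪ tip i (-1)) := by
    intro f hf
    by_cases h : ∀ i, |f i| ≤ 2
    · exact Or.inl ⟨h, hf⟩
    · push Not at h
      obtain ⟨i, hi⟩ := h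
      refine Or.inr (Set.mem_iUnion.2 ⟨i, ?_⟩)
      rcases le_or_gt 0 (f i) with hfi | hfi
      · left; refine ⟨?_, hf⟩; rw [abs_of_nonneg hfi] at hi; linarith
      · right; refine ⟨?_, hf⟩; rw [abs_of_neg hfi] at hi; linarith
  have hO36 : volume O = ENNReal.ofReal 36 := by
    rw [hO, volume_l1Ball 3, ← ENNReal.ofReal_pow (by norm_num), ← ENNReal.ofReal_mul (by norm_num)]
    norm_num
  have htips : volume (⋃ i, (tip i 1 ∪ tip i (-1))) ≤ ENNReal.ofReal 4 := by
    refine (measure_iUnion_le _).trans ?_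
    have h1 : ∀ i, volume (tip i 1 ∪ tip i (-1)) ≤ ENNReal.ofReal (2 / 3) + ENNReal.ofReal (2 / 3) :=
      fun i => (measure_union_le _ _).trans (add_le_add (volume_tip_le i (Or.inl rfl))
        (volume_tip_le i (Or.inr rfl)))
    calc ∑' i, volume (tip i 1 ∪ tip i (-1)) = ∑ i, volume (tip i 1 ∪ tip i (-1)) :=
          tsum_fintype _
      _ ≤ ∑ _i : Fin 3, (ENNReal.ofReal (2 / 3) + ENNReal.ofReal (2 / 3)) :=
          Finset.sum_le_sum fun i _ => h1 i
      _ = ENNReal.ofReal 4 := by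
          rw [Finset.sum_const, Finset.card_univ, Fintype.card_fin, ← ENNReal.ofReal_add
            (by norm_num) (by norm_num), nsmul_eq_mul,
            show ((3 : ℕ) : ℝ≥0∞) = ENNReal.ofReal 3 by simp, ← ENNReal.ofReal_mul (by norm_num)]
          norm_num
  have hle : volume O ≤ volume T + ENNReal.ofReal 4 :=
    (measure_mono hcover).trans ((measure_union_le _ _).trans (add_le_add le_rfl htips))
  rw [hO36] at hle
  by_contra h
  push Not at h
  have h2 : volume T + ENNReal.ofReal 4 < ENNReal.ofReal 32 + ENNReal.ofReal 4 :=
    ENNReal.add_lt_add_right ENNReal.ofReal_ne_top h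
  rw [← ENNReal.ofReal_add (by norm_num) (by norm_num), show (32 : ℝ) + 4 = 36 by norm_num] at h2
  exact absurd (hle.trans_lt h2) (lt_irrefl _)

/-! ### Transfer to `EuclideanSpace ℝ (Fin 3)` and the Wulff body -/

/-- **The truncated octahedron has volume at least `32`** (in `EuclideanSpace ℝ (Fin 3)`):
`32 ≤ vol {x | ‖x‖_∞ ≤ 2, ‖x‖₁ ≤ 3}`. [cite: CicaleseKreutzLeonardi2023, Proposition 2.4 (24), proof Step 3] -/
theorem le_volume_truncOct :
    ENNReal.ofReal 32 ≤
      volume {x : EuclideanSpace ℝ (Fin 3) | (∀ i, |x i| ≤ 2) ∧ ∑ i, |x i| ≤ 3} := by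
  have hcoord : ∀ i, Measurable fun x : EuclideanSpace ℝ (Fin 3) => |x i| := fun i =>
    (EuclideanSpace.proj (𝕜 := ℝ) i).continuous.abs.measurable
  have hm : MeasurableSet {x : EuclideanSpace ℝ (Fin 3) | (∀ i, |x i| ≤ 2) ∧ ∑ i, |x i| ≤ 3} := by
    rw [Set.setOf_and]
    refine MeasurableSet.inter ?_ (measurableSet_le (Finset.measurable_sum _ fun i _ => hcoord i)
      measurable_const)
    have : {x : EuclideanSpace ℝ (Fin 3) | ∀ i, |x i| ≤ 2} = ⋂ i, {x | |x i| ≤ 2} := by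
      ext x; simp
    rw [this]
    exact MeasurableSet.iInter fun i => measurableSet_le (hcoord i) measurable_const
  rw [← (PiLp.volume_preserving_toLp (Fin 3)).measure_preimage hm.nullMeasurableSet]
  exact le_volume_truncOct_pi

/-- **The fcc Wulff body has volume at least `32`**: `32 ≤ vol {x | ∀ μ, ⟪x, μ⟫ ≤ φ_fcc(μ)}`
(it contains the truncated octahedron `{‖x‖_∞ ≤ 2} ∩ {‖x‖₁ ≤ 3}` of volume `32`).
[cite: CicaleseKreutzLeonardi2023, Proposition 2.4 (24), proof Step 3] -/
theorem le_volume_fccWulffSet :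
    ENNReal.ofReal 32 ≤
      volume {x : EuclideanSpace ℝ (Fin 3) | ∀ μ : EuclideanSpace ℝ (Fin 3), ⟪x, μ⟫ ≤ phiFcc μ} :=
  le_volume_truncOct.trans (measure_mono fun _ hx μ => inner_le_phiFcc_of_mem_truncOct hx.1 hx.2 μ)

end Literature.MathematicalPhysics.StatisticalMechanics

end
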